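import Summits.CriticalPhenomena.CardyFormulaZ2.Theses.CardyBoundaryCoulombGas
import Summits.CriticalPhenomena.CardyFormulaZ2.Theorems.CardyBoundaryCoulombGasStripClusterRatesBetheKernelIntegral

/-!
# The normalised Bethe kernel contracts sup norms by `1/3`
# (line `two-cluster-rate-is-stationary-gap`, crux `StripClusterRates`,
# stmt-CriticalPhenomena-13878)

Condensation building block of the Bethe-asymptotics pillar: with the scattering kernel
`G'(x) = (√3/2)/(cosh 2x + 1/2)` (positive, integrable, total mass `∫_ℝ G' = π/3`,
`bu_kernel_integral`) and `K := G'/π`, the convolution operator `u ↦ K ⋆ u` is an `L^∞`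
contraction with constant `1/3`: for every measurable `u` with `|u| ≤ B`,

  `|∫ K(x - y) u(y) dy| ≤ B/3`  for all `x`.

Proof. Dominate the integrand by the integrable function `y ↦ (B/π) G'(x - y)`
(`MeasureTheory.norm_integral_le_of_norm_le`; `G' > 0`, `|u y| ≤ B`), and evaluate
`∫ (B/π) G'(x - y) dy = (B/π) ∫ G' = (B/π)(π/3) = B/3` by translation/reflection invariance of
Lebesgue measure (`MeasureTheory.integral_sub_left_eq_self`). No integrability of `u` itself is
needed beyond the pointwise bound (the dominated side is only required almost everywhere).
-/

noncomputable section

namespace Summit.CriticalPhenomena.CardyFormulaZ2.Cruxes.StripClusterRates.TwoClusterRateIsStationaryGap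

open Filter MeasureTheory

/-- Translates of the scattering kernel have the same total mass:
`∫ (√3/2)/(cosh 2(x - y) + 1/2) dy = π/3` (Lebesgue measure is invariant under `y ↦ x - y`).
[folklore] -/
theorem bu_kernel_integral_sub_left (x : ℝ) :
    (∫ y : ℝ, Real.sqrt 3 / 2 / (Real.cosh (2 * (x - y)) + 1 / 2)) = Real.pi / 3 := by
  have h := integral_sub_left_eq_self
    (fun t : ℝ ↦ Real.sqrt 3 / 2 / (Real.cosh (2 * t) + 1 / 2)) volume x
  rw [h]
  exact bu_kernel_integral.1

/-- Translates of the scattering kernel are integrable: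
`y ↦ (√3/2)/(cosh 2(x - y) + 1/2)` is integrable on `ℝ`. [folklore] -/
theorem bu_kernel_integrable_sub_left (x : ℝ) :
    Integrable (fun y : ℝ ↦ Real.sqrt 3 / 2 / (Real.cosh (2 * (x - y)) + 1 / 2)) :=
  bu_kernel_integrable.comp_sub_left x

/-- **Sup-norm contraction of the normalised Bethe kernel** (registered stub
`bu_kernel_conv_bound`): for measurable `u` with `|u| ≤ B` and every `x`,
`|∫ (√3/2)/(cosh 2(x - y) + 1/2)/π · u(y) dy| ≤ B/3`. Domination by `(B/π) G'(x - ·)`, whose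
integral is `(B/π)(π/3) = B/3`. [folklore] -/
theorem bu_kernel_conv_bound : ∀ (u : ℝ → ℝ) (B : ℝ), Measurable u → (∀ y, |u y| ≤ B) → ∀ x : ℝ, |∫ y : ℝ, Real.sqrt 3 / 2 / (Real.cosh (2 * (x - y)) + 1 / 2) / Real.pi * u y| ≤ B / 3 := by
  intro u B _hu hB x
  have hpi : 0 < Real.pi := Real.pi_pos
  -- the integrable dominating function `y ↦ (B/π) G'(x - y)`
  have hg : Integrable
      (fun y : ℝ ↦ B / Real.pi * (Real.sqrt 3 / 2 / (Real.cosh (2 * (x - y)) + 1 / 2))) :=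
    (bu_kernel_integrable_sub_left x).const_mul (B / Real.pi)
  -- pointwise domination
  have hle : ∀ᵐ y : ℝ, ‖Real.sqrt 3 / 2 / (Real.cosh (2 * (x - y)) + 1 / 2) / Real.pi * u y‖
      ≤ B / Real.pi * (Real.sqrt 3 / 2 / (Real.cosh (2 * (x - y)) + 1 / 2)) := by
    refine Eventually.of_forall fun y => ?_
    have hK : 0 < Real.sqrt 3 / 2 / (Real.cosh (2 * (x - y)) + 1 / 2) := bu_kernel_pos (x - y)
    have hKpi : 0 < Real.sqrt 3 / 2 / (Real.cosh (2 * (x - y)) + 1 / 2) / Real.pi :=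
      div_pos hK hpi
    rw [Real.norm_eq_abs, abs_mul, abs_of_pos hKpi]
    calc Real.sqrt 3 / 2 / (Real.cosh (2 * (x - y)) + 1 / 2) / Real.pi * |u y|
        ≤ Real.sqrt 3 / 2 / (Real.cosh (2 * (x - y)) + 1 / 2) / Real.pi * B :=
          mul_le_mul_of_nonneg_left (hB y) hKpi.le
      _ = B / Real.pi * (Real.sqrt 3 / 2 / (Real.cosh (2 * (x - y)) + 1 / 2)) := by ring
  have h := norm_integral_le_of_norm_le hg hle
  rw [Real.norm_eq_abs] at h
  refine h.trans_eq ?_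
  rw [integral_const_mul, bu_kernel_integral_sub_left]
  field_simp

end Summit.CriticalPhenomena.CardyFormulaZ2.Cruxes.StripClusterRates.TwoClusterRateIsStationaryGap

end
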